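import Mathlib
import Summits.ResolutionOfSingularities.ResolutionOfSingularities.Theorems.WeightedInvariantGlobalizeLocalDropCanonize
import Summits.ResolutionOfSingularities.ResolutionOfSingularities.Theorems.WeightedInvariantLocalWeightedDropMonicRecentre
import Summits.ResolutionOfSingularities.ResolutionOfSingularities.Theorems.WeightedInvariantLocalWeightedDropMonicDescentDefs
import Summits.ResolutionOfSingularities.ResolutionOfSingularities.Theorems.WeightedInvariantLocalWeightedDropMonicDescentLabels

/-!
# `WeightedInvariant.LocalWeightedDrop`, sub-stub `stub_monicDoublePointDescends`: the strategy Σ** and the composition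
# "preparation + game bridge + no infinite Σ**-chain ⇒ every reduced position descends" (pieces T-1′/T-6′/T-5′ of the N4″ plan)

Crux item stmt-ResolutionOfSingularities-8899 `LocalWeightedDrop` (route `ResolutionOfSingularities/WeightedInvariant`), door
`WeightedConstruction` stmt-ResolutionOfSingularities-0571.  [OURS · L1 W4.3, chain w43, lead prover.  Objects the engine line posits; the
termination proof follows Cossart–Jannsen–Saito LNM 2270 Ch. 13 as a MAP (plan `N4PRIME-PLAN.md`, evidence on stmt-8899); nothing here is a
statement of any manuscript.]

DEFINITIONS (labels = pairs `(A₀, A₁)` over `k[[u₁,u₂]]`, see `…MonicDescentLabels`):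
* `IsPrepRecentring A₀ A₁ ψ` — `ψ` is a WELL-PREPARING re-centring: `ψ(0) = 0`, the re-centred label is a well-prepared position, and every
  odd vertex of the old scaled Newton set stays a vertex with the same `A₀`-coefficient (CJS Lemma 11.4 / Thm 8.24 shape); `prep A` — the
  label re-centred by an `ε`-chosen well-preparing `ψ` (its specification is piece T-1′);
* `HasGraphCurve A` — some regular near curve is a GRAPH OVER `u₁`: after a `u₂`-shear by a series `h(u₁)` and a re-centring, `V(y, ũ₂)` is
  permissible; `graphShear A` — an `ε`-chosen such `h`;
* `succLabels A` — the SUCCESSOR LABELS of the strategy Σ**: `V(y,u₁)` permissible ↦ divide by `(u₁², u₁)`; else `V(y,u₂)` permissible ↦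
  divide by `(u₂², u₂)`; else a graph curve ↦ shear, prepare, divide by `(ũ₂², ũ₂)`; else the POINT BLOW-UP: the `u₁`-chart label, the `u₂`-chart
  label, and for every `λ ≠ 0` the `u₁`-chart label of the prepared `λ`-sheared label (Refuter's points `(1:0)`, `(0:1)`, `(1:λ)`).
THE COMPOSITION `descends_of_pieces`: if (T-1′) every position has a well-preparing re-centring, (T-6′) at every well-prepared reduced
position the move of Σ** satisfies the clauses of the descent game with all non-hyperbolic singular slices formally re-presented by
well-prepared positions in `succLabels`, and (T-5′) there is no infinite chain of well-prepared reduced positions through `succLabels`, then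
every reduced position is in the attractor `MonicDescent.Descends` — i.e. the registered stub `stub_monicDoublePointDescends` of skeleton v22,
hence N4″ (`formalStep_of_descends`), hence S2.  Proof: `Represents` is reflexive/transitive and holds for re-centrings; a well-prepared reduced
position all of whose Σ**-successors descend, descends (stage = `sup + 1`); dependent choice.
-/

set_option linter.dupNamespace false -- mandated namespace of this single-conjunct summit

noncomputable section

namespace Summit.ResolutionOfSingularities.ResolutionOfSingularities.Theorems

namespace MonicDescent

open MvPowerSeries Literature.AlgebraicGeometry.Resolution

variable {k : Type} [Field k]

/-- A LABEL: a pair `(A₀, A₁)` over `k[[u₁,u₂]]`. -/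
abbrev Label (k : Type) [Field k] : Type := MvPowerSeries (Fin 2) k × MvPowerSeries (Fin 2) k

/-! ## Σ**: preparation, graph curves, successor labels -/

/-- `ψ` is a WELL-PREPARING RE-CENTRING of `(A₀, A₁)`: `ψ(0) = 0`, the re-centred label `recentre ψ A₀ A₁` is a position and well
prepared, and every ODD VERTEX of the old scaled Newton set is still a vertex, with the same `A₀`-coefficient. -/
def IsPrepRecentring (A₀ A₁ ψ : MvPowerSeries (Fin 2) k) : Prop :=
  constantCoeff ψ = 0 ∧ IsPosition (recentre ψ A₀ A₁).1 (recentre ψ A₀ A₁).2 ∧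
    WellPrepared (recentre ψ A₀ A₁).1 (recentre ψ A₀ A₁).2 ∧
    ∀ P, IsVertex (newtonSet A₀ A₁) P → IsOdd A₀ A₁ P →
      IsVertex (newtonSet (recentre ψ A₀ A₁).1 (recentre ψ A₀ A₁).2) P ∧ coeff P (recentre ψ A₀ A₁).1 = coeff P A₀

/-- An `ε`-chosen well-preparing re-centring (junk if none exists; piece T-1′ says one exists for every position). -/
def prepPsi (A₀ A₁ : MvPowerSeries (Fin 2) k) : MvPowerSeries (Fin 2) k :=
  Classical.epsilon (IsPrepRecentring A₀ A₁)

/-- The PREPARED LABEL `prep A = recentre (prepPsi A) A`. -/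
def prep (A : Label k) : Label k := recentre (prepPsi A.1 A.2) A.1 A.2

/-- The specification of `prep`, given existence. -/
theorem isPrepRecentring_prepPsi {A₀ A₁ : MvPowerSeries (Fin 2) k} (h : ∃ ψ, IsPrepRecentring A₀ A₁ ψ) :
    IsPrepRecentring A₀ A₁ (prepPsi A₀ A₁) :=
  Classical.epsilon_spec h

/-- The sheared label `(A₀, A₁)(u₁, u₂ + u₁h)`. -/
def shearLabel (h : MvPowerSeries (Fin 2) k) (A : Label k) : Label k := (shear h A.1, shear h A.2)

/-- `u₁`-chart point blow-up of a label. -/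
def blowOneLabel (A : Label k) : Label k := (blowOne 2 A.1, blowOne 1 A.2)

/-- `u₂`-chart point blow-up of a label. -/
def blowTwoLabel (A : Label k) : Label k := (blowTwo 2 A.1, blowTwo 1 A.2)

/-- Blow-up of `V(y, u₁)`: divide by `(u₁², u₁)`. -/
def divOneLabel (A : Label k) : Label k := (divOne 2 A.1, divOne 1 A.2)

/-- Blow-up of `V(y, u₂)`: divide by `(u₂², u₂)`. -/
def divTwoLabel (A : Label k) : Label k := (divTwo 2 A.1, divTwo 1 A.2)

/-- Some regular near curve through the point is a GRAPH OVER `u₁`: for some `h = h(u₁)` (no `u₂`) and some re-centring `ψ`, the curve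
`V(y, ũ₂)`, `ũ₂ = u₂ + u₁h`, is permissible for the sheared re-centred label.  (Case (a″) of Σ**.) -/
def HasGraphCurve (A : Label k) : Prop :=
  ∃ h ψ : MvPowerSeries (Fin 2) k, (∀ e : Fin 2 →₀ ℕ, e 1 ≠ 0 → coeff e h = 0) ∧ constantCoeff ψ = 0 ∧
    IsPermissibleTwo (recentre ψ (shear h A.1) (shear h A.2)).1 (recentre ψ (shear h A.1) (shear h A.2)).2

/-- An `ε`-chosen graph-curve shear `h(u₁)`. -/
def graphShear (A : Label k) : MvPowerSeries (Fin 2) k :=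
  Classical.epsilon fun h : MvPowerSeries (Fin 2) k => ∃ ψ : MvPowerSeries (Fin 2) k,
    (∀ e : Fin 2 →₀ ℕ, e 1 ≠ 0 → coeff e h = 0) ∧ constantCoeff ψ = 0 ∧
    IsPermissibleTwo (recentre ψ (shear h A.1) (shear h A.2)).1 (recentre ψ (shear h A.1) (shear h A.2)).2

open Classical in
/-- THE SUCCESSOR LABELS OF THE STRATEGY Σ** at a (well-prepared) label `A`:
(a′) `V(y,u₁)` permissible ↦ `{A/(u₁²,u₁)}`; else `V(y,u₂)` permissible ↦ `{A/(u₂²,u₂)}`;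
(a″) else a graph curve ↦ `{prep(shear_h A)/(ũ₂², ũ₂)}`;
(b) else the point blow-up: `u₁`-chart of `A`, `u₂`-chart of `A`, and for every `λ ≠ 0` the `u₁`-chart of `prep(shear_λ A)`. -/
def succLabels (A : Label k) : Set (Label k) :=
  if IsPermissibleOne A.1 A.2 then {divOneLabel A}
  else if IsPermissibleTwo A.1 A.2 then {divTwoLabel A}
  else if HasGraphCurve A then {divTwoLabel (prep (shearLabel (graphShear A) A))}
  else {blowOneLabel A, blowTwoLabel A} ∪
    {B | ∃ c : k, c ≠ 0 ∧ B = blowOneLabel (prep (shearLabel (C c) A))}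

/-! ## `Represents`: reflexive, transitive, re-centrings -/

variable {n : ℕ}

/-- `Represents` is reflexive. -/
theorem represents_refl (B₀ B₁ : MvPowerSeries (Fin (n + 2)) k) : Represents (pos B₀ B₁) B₀ B₁ := by
  refine ⟨MvPowerSeries.X, 1, fun i => constantCoeff_X i, ?_, one_ne_zero, ?_⟩
  · have : FormalCoordChange.linMat (MvPowerSeries.X : Fin (n + 3) → MvPowerSeries (Fin (n + 3)) k) = 1 := by
      ext i j
      simp [FormalCoordChange.linMat, Matrix.of_apply, coeff_X, Matrix.one_apply, Finsupp.single_eq_single_iff, eq_comm]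
    rw [this, Matrix.det_one]
    exact isUnit_one
  · rw [subst_self, one_mul]
    rfl

/-- `Represents` is transitive: `θ^* S = H · pos B` and `θ′^* (pos B) = H′ · pos B′` give `(θ′ ∘ θ)^* S = θ′^*H · H′ · pos B′`. -/
theorem represents_trans {S : MvPowerSeries (Fin (n + 3)) k} {B₀ B₁ B₀' B₁' : MvPowerSeries (Fin (n + 2)) k}
    (h : Represents S B₀ B₁) (h' : Represents (pos B₀ B₁) B₀' B₁') : Represents S B₀' B₁' := by
  obtain ⟨θ, H, hθ0, hθdet, hH, hS⟩ := h
  obtain ⟨θ', H', hθ'0, hθ'det, hH', hB⟩ := h'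
  have hθs := hasSubst_of_constantCoeff_zero hθ0
  have hθ's := hasSubst_of_constantCoeff_zero hθ'0
  refine ⟨fun i => subst θ' (θ i), subst θ' H * H', constantCoeff_comp_eq_zero hθ0 hθ'0, ?_, ?_, ?_⟩
  · rw [linMat_comp θ hθ'0, Matrix.det_mul]
    exact hθdet.mul hθ'det
  · rw [map_mul, constantCoeff_subst_of_constantCoeff_zero _ hθ'0]
    exact mul_ne_zero hH hH'
  · rw [← subst_comp_subst_apply hθs hθ's, hS, subst_mul hθ's, hB, mul_assoc]

/-- A RE-CENTRING IS A RE-PRESENTATION: `pos (A₀, A₁)` is represented by `recentre ψ A₀ A₁` (`ψ(0) = 0`). -/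
theorem represents_recentre (ψ A₀ A₁ : MvPowerSeries (Fin (n + 2)) k) (hψ : constantCoeff ψ = 0) :
    Represents (pos A₀ A₁) (recentre ψ A₀ A₁).1 (recentre ψ A₀ A₁).2 := by
  -- adapted from `won_monic_two_recentre_iff`
  obtain ⟨τ, hτ⟩ : ∃ τ : Fin (n + 3) → MvPowerSeries (Fin (n + 3)) k,
      ∀ l, τ l = if l = Fin.last (n + 2) then X (Fin.last (n + 2)) + rename (Fin.succAboveEmb (Fin.last (n + 2))) ψ else X l :=
    ⟨_, fun _ => rfl⟩
  have hτeq : τ = fun l : Fin (n + 3) => if l = Fin.last (n + 2)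
      then X (Fin.last (n + 2)) + rename (Fin.succAboveEmb (Fin.last (n + 2))) ψ else X l := funext hτ
  have hτ0 : ∀ l, constantCoeff (τ l) = 0 := by
    intro l
    rw [hτ]
    split_ifs
    · rw [map_add, constantCoeff_X, constantCoeff_rename, hψ, add_zero]
    · exact constantCoeff_X l
  have hc1 : coeff (Finsupp.single (Fin.last (n + 2)) 1) (rename (Fin.succAboveEmb (Fin.last (n + 2))) ψ) = 0 := by
    have h := TschirnhausForm.coeff_emb_add_single_rename (m := n + 2) (0 : Fin (n + 2) →₀ ℕ) 1 ψ
    rw [Finsupp.embDomain_zero, zero_add, if_neg one_ne_zero] at h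
    exact h
  have hτdet : IsUnit (FormalCoordChange.linMat τ).det := by
    rw [FormalCoordChange.linMat, TschirnhausForm.det_of_offLast_rows]
    · rw [Matrix.of_apply, hτ, if_pos rfl, map_add, coeff_index_single_self_X, hc1, add_zero]
      exact isUnit_one
    · intro l j hl
      rw [Matrix.of_apply, hτ, if_neg hl, coeff_index_single_X]
  refine ⟨τ, 1, hτ0, hτdet, one_ne_zero, ?_⟩
  rw [one_mul, hτeq, pos, MonicRecentre.subst_shear_monic_two ψ hψ A₀ A₁]
  rfl

/-- Double planes pull back along re-centrings: if `recentre ψ A` is `(r², 2r)` then `A = ((r − ψ)², 2(r − ψ))`. -/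
theorem isDoublePlane_of_recentre {ψ A₀ A₁ : MvPowerSeries (Fin (n + 2)) k}
    (h : IsDoublePlane (recentre ψ A₀ A₁).1 (recentre ψ A₀ A₁).2) : IsDoublePlane A₀ A₁ := by
  obtain ⟨r, h₁, h₀⟩ := h
  change A₁ + 2 * ψ = 2 * r at h₁
  change A₀ + A₁ * ψ + ψ ^ 2 = r ^ 2 at h₀
  refine ⟨r - ψ, ?_, ?_⟩
  · linear_combination h₁
  · linear_combination h₀ - ψ * h₁

/-! ## The composition -/

/-- A WELL-PREPARED REDUCED POSITION ALL OF WHOSE Σ**-SUCCESSORS DESCEND, DESCENDS — and so does every position it represents — provided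
the move of Σ** satisfies the clauses of the descent game (hypothesis `hstep`, the shape of piece T-6′ at this label). -/
theorem descends_of_succ {B : Label k} {A₀ A₁ : MvPowerSeries (Fin 2) k} (hrep : Represents (pos A₀ A₁) B.1 B.2)
    (hstep : ∃ (B' : Label k) (φ : MvPowerSeries (Fin 2) k), constantCoeff φ = 0 ∧ IsPosition B'.1 B'.2 ∧
      IsPosition (recentre φ B'.1 B'.2).1 (recentre φ B'.1 B'.2).2 ∧ Represents (pos B.1 B.2) B'.1 B'.2 ∧
      (PointClause B'.1 B'.2 φ (fun S => IsHyperbolic S ∨ ∃ A' ∈ succLabels B,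
          IsPosition A'.1 A'.2 ∧ WellPrepared A'.1 A'.2 ∧ Represents S A'.1 A'.2) ∨
       CurveClause B'.1 B'.2 φ (fun S => IsHyperbolic S ∨ ∃ A' ∈ succLabels B,
          IsPosition A'.1 A'.2 ∧ WellPrepared A'.1 A'.2 ∧ Represents S A'.1 A'.2)))
    (hsucc : ∀ A' ∈ succLabels B, IsPosition A'.1 A'.2 → WellPrepared A'.1 A'.2 → Descends A'.1 A'.2) :
    Descends A₀ A₁ := by
  obtain ⟨B', φ, hφ, hB', hB'φ, hrepB, hclause⟩ := hstep
  -- the stage: one more than every successor's stage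
  let ι : Type := {A' : Label k // A' ∈ succLabels B ∧ IsPosition A'.1 A'.2 ∧ WellPrepared A'.1 A'.2}
  let f : ι → Ordinal.{0} := fun A' => stage A'.1.1 A'.1.2 + 1
  refine ⟨iSup f, ?_⟩
  rw [descendsBy_iff]
  right
  refine ⟨B'.1, B'.2, hB', represents_trans hrep hrepB, φ, hφ, hB'φ, ?_⟩
  have hgood : ∀ S, (IsHyperbolic S ∨ ∃ A' ∈ succLabels B,
      IsPosition A'.1 A'.2 ∧ WellPrepared A'.1 A'.2 ∧ Represents S A'.1 A'.2) →
      (IsHyperbolic S ∨ ∃ A₀' A₁' : MvPowerSeries (Fin 2) k, IsPosition A₀' A₁' ∧ Represents S A₀' A₁' ∧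
        ∃ (β : Ordinal.{0}) (_ : β < iSup f), DescendsBy β A₀' A₁') := by
    rintro S (hh | ⟨A', hA', hpos, hwp, hrepS⟩)
    · exact Or.inl hh
    · refine Or.inr ⟨A'.1, A'.2, hpos, hrepS, stage A'.1 A'.2, ?_, descendsBy_stage (hsucc A' hA' hpos hwp)⟩
      have hle : f ⟨A', hA', hpos, hwp⟩ ≤ iSup f := Ordinal.le_iSup f ⟨A', hA', hpos, hwp⟩
      exact lt_of_lt_of_le (Order.lt_succ _) hle
  rcases hclause with hp | hc
  · exact Or.inl (hp.mono hgood)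
  · exact Or.inr (hc.mono hgood)

/-- THE COMPOSITION (OURS · L1 W4.3): preparation (T-1′) + game bridge for Σ** (T-6′) + no infinite Σ**-chain (T-5′) ⇒ every reduced
position descends (= the registered stub `stub_monicDoublePointDescends` of skeleton v22). -/
theorem descends_of_pieces
    (hT1 : ∀ (k : Type) [Field k] [CharP k 2] [IsAlgClosed k] (A₀ A₁ : MvPowerSeries (Fin 2) k),
      IsPosition A₀ A₁ → ∃ ψ, IsPrepRecentring A₀ A₁ ψ)
    (hT6 : ∀ (k : Type) [Field k] [CharP k 2] [IsAlgClosed k] (B : Label k),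
      WellPrepared B.1 B.2 → IsPosition B.1 B.2 → ¬ IsDoublePlane B.1 B.2 →
      ∃ (B' : Label k) (φ : MvPowerSeries (Fin 2) k), constantCoeff φ = 0 ∧ IsPosition B'.1 B'.2 ∧
        IsPosition (recentre φ B'.1 B'.2).1 (recentre φ B'.1 B'.2).2 ∧ Represents (pos B.1 B.2) B'.1 B'.2 ∧
        (PointClause B'.1 B'.2 φ (fun S => IsHyperbolic S ∨ ∃ A' ∈ succLabels B,
            IsPosition A'.1 A'.2 ∧ WellPrepared A'.1 A'.2 ∧ Represents S A'.1 A'.2) ∨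
         CurveClause B'.1 B'.2 φ (fun S => IsHyperbolic S ∨ ∃ A' ∈ succLabels B,
            IsPosition A'.1 A'.2 ∧ WellPrepared A'.1 A'.2 ∧ Represents S A'.1 A'.2)))
    (hT5 : ∀ (k : Type) [Field k] [CharP k 2] [IsAlgClosed k],
      ¬ ∃ A : ℕ → Label k, ∀ m, WellPrepared (A m).1 (A m).2 ∧ IsPosition (A m).1 (A m).2 ∧
        ¬ IsDoublePlane (A m).1 (A m).2 ∧ A (m + 1) ∈ succLabels (A m)) :
    ∀ (k : Type) [Field k] [CharP k 2] [IsAlgClosed k] (A₀ A₁ : MvPowerSeries (Fin 2) k),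
      IsPosition A₀ A₁ → ¬ IsDoublePlane A₀ A₁ → Descends A₀ A₁ := by
  intro k _ _ _ A₀ A₁ hA hred
  by_contra hnot
  -- the BAD labels: well-prepared reduced positions representing some non-descending position
  let Bad : Set (Label k) := {B | WellPrepared B.1 B.2 ∧ IsPosition B.1 B.2 ∧ ¬ IsDoublePlane B.1 B.2 ∧
    ∃ A₀ A₁ : MvPowerSeries (Fin 2) k, Represents (pos A₀ A₁) B.1 B.2 ∧ ¬ Descends A₀ A₁}
  -- every bad label has a bad Σ**-successor
  have hnext : ∀ B ∈ Bad, ∃ B' ∈ succLabels B, B' ∈ Bad := by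
    rintro B ⟨hwp, hpos, hredB, A₀, A₁, hrep, hnd⟩
    by_contra hall
    push Not at hall
    apply hnd
    refine descends_of_succ hrep (hT6 k B hwp hpos hredB) fun A' hA' hpos' hwp' => ?_
    by_contra hnd'
    by_cases hpl : IsDoublePlane A'.1 A'.2
    · exact hnd' ⟨0, by rw [descendsBy_iff]; exact Or.inl hpl⟩
    · exact hall A' hA' ⟨hwp', hpos', hpl, A'.1, A'.2, represents_refl A'.1 A'.2, hnd'⟩
  -- a bad starting label: the prepared re-centring of `A`
  obtain ⟨ψ, hψ0, hψpos, hψwp, -⟩ := hT1 k A₀ A₁ hA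
  have hB₀ : (recentre ψ A₀ A₁) ∈ Bad :=
    ⟨hψwp, hψpos, fun hpl => hred (isDoublePlane_of_recentre hpl), A₀, A₁, represents_recentre ψ A₀ A₁ hψ0, hnot⟩
  -- dependent choice: an infinite Σ**-chain of bad labels
  choose! nxt hnxt using hnext
  let seq : ℕ → Label k := fun m => Nat.rec (recentre ψ A₀ A₁) (fun _ B => nxt B) m
  have hseq : ∀ m, seq m ∈ Bad := by
    intro m
    induction m with
    | zero => exact hB₀
    | succ m ih => exact (hnxt _ ih).2
  exact hT5 k ⟨seq, fun m => ⟨(hseq m).1, (hseq m).2.1, (hseq m).2.2.1, (hnxt _ (hseq m)).1⟩⟩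

end MonicDescent

end Summit.ResolutionOfSingularities.ResolutionOfSingularities.Theorems

end
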